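import Literature.Combinatorics.Hypergraph.FGKMTProbabilisticCovering
import HarnessLib

/-!
# Ford–Green–Konyagin–Maynard–Tao 2018, §5 (proof of the covering theorem): finite-probability kit

Topic `Literature/Combinatorics/Hypergraph`. Source: K. Ford, B. Green, S. Konyagin, J. Maynard, T. Tao,
*Long gaps between primes*, J. Amer. Math. Soc. 31 (2018) 65–105 = arXiv:1412.5029
[FordGreenKonyaginMaynardTao2018], §5 «Proof of covering theorem», pp. 19–22 (arXiv pp. 14–16), and
§4.2, (4.7)–(4.14), Lemma 4.1 (Chebyshev).

This file PROVES the elementary tools used throughout the proof of Theorem 3 (`FGKMT2018_theorem3`,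
typed in `FGKMTProbabilisticCovering.lean`), in the law-based rendering of that file:
* the multiplicative set weights `P(S) = ∏_{v ∈ S} p(v)` («by (4.14) … `P(ẽ ∪ ê)/(P(ẽ)P(ê)) = 1/P(ẽ ∩ ê)`»,
  `P_j(ẽ) ≥ κ^{#ẽ}`);
* the membership probabilities `P(v ∈ 𝐞)`, `P(v, w ∈ 𝐞)` as indicator sums and the counting identities
  `E #(𝐞 ∩ e) = ∑_{v ∈ e} P(v ∈ 𝐞)`, `E 1_{v ∈ 𝐞} #((𝐞 ∩ e) ∖ {v}) = ∑_{w ∈ e ∖ {v}} P(v, w ∈ 𝐞)`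
  («by (4.7), (4.8) and a union bound», «inclusion–exclusion»);
* Markov's and Chebyshev's inequalities for a weighted finite sum (Lemma 4.1 of the paper);
* the Taylor facts `e^{-u-2u²} ≤ 1 − u ≤ e^{-u}` (`0 ≤ u ≤ 1/2`) behind «From Taylor's expansion, we then
  have `1 − P = exp(−P + O(P²))`», and `|1/x − 1| ≤ 2t` for `|x − 1| ≤ t ≤ 1/2` (display (5.3), the event `F_i`).

## Main statements
* `pw`, `pw_union_inter`, `pw_anti`, `pow_card_le_pw`, `mul_pw_erase`;
* `probMem_eq_sum_ite`, `probPairMem_eq_sum_ite`, `sum_mul_card_inter`, `sum_mul_ite_card_erase`,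
  `card_sub_ite_le_sum_pairs`;
* `weighted_markov`;
* `prod_one_sub_bounds`, `abs_inv_sub_one_le`, `exp_mul_one_add_sub_one_le`, `one_sub_exp_neg_mul_le`
  (the scalar Taylor facts behind them are private helpers).
-/

noncomputable section

open Finset

namespace Literature.Combinatorics.Hypergraph

namespace FGKMTCovering

section Weights

variable {V : Type*}

/-! ### Multiplicative set weights `P(S) = ∏_{v ∈ S} p(v)` -/

/-- The multiplicative weight `P(S) := ∏_{v ∈ S} p(v)` of a finite set (`P_j(e)` of (4.14) is
`pw (P_j ·) e`). [cite: FordGreenKonyaginMaynardTao2018, (4.14)] -/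
def pw (p : V → ℝ) (S : Finset V) : ℝ := ∏ v ∈ S, p v

/-- [cite: FordGreenKonyaginMaynardTao2018, (4.14)] -/
theorem levelProbSet_eq_pw {ι : Type*} [Fintype V] [DecidableEq V] (μ : ι → Finset V → ℝ) (I : ℕ → Finset ι)
    (j : ℕ) (e : Finset V) : levelProbSet μ I j e = pw (levelProb μ I j) e := rfl

/-- [cite: FordGreenKonyaginMaynardTao2018, (4.14)] -/
@[simp] theorem pw_empty (p : V → ℝ) : pw p ∅ = 1 := by simp [pw]

/-- [cite: FordGreenKonyaginMaynardTao2018, (4.14)] -/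
theorem pw_singleton (p : V → ℝ) (v : V) : pw p {v} = p v := by simp [pw]

/-- `P(S ∪ S') P(S ∩ S') = P(S) P(S')` («`P(ẽ ∪ ê)/(P(ẽ)P(ê)) = 1/P(ẽ ∩ ê)`»).
[cite: FordGreenKonyaginMaynardTao2018, §5 proof of Lemma 5.1] -/
theorem pw_union_inter [DecidableEq V] (p : V → ℝ) (S S' : Finset V) :
    pw p (S ∪ S') * pw p (S ∩ S') = pw p S * pw p S' :=
  Finset.prod_union_inter

/-- [cite: FordGreenKonyaginMaynardTao2018, (4.13)–(4.14)] -/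
theorem pw_pos {p : V → ℝ} (hp : ∀ v, 0 < p v) (S : Finset V) : 0 < pw p S :=
  Finset.prod_pos fun v _ => hp v

/-- [cite: FordGreenKonyaginMaynardTao2018, (4.10)–(4.14)] -/
theorem pw_nonneg {p : V → ℝ} (hp : ∀ v, 0 ≤ p v) (S : Finset V) : 0 ≤ pw p S :=
  Finset.prod_nonneg fun v _ => hp v

/-- [cite: FordGreenKonyaginMaynardTao2018, (4.10)–(4.14)] -/
theorem pw_le_one {p : V → ℝ} (hp0 : ∀ v, 0 ≤ p v) (hp1 : ∀ v, p v ≤ 1) (S : Finset V) :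
    pw p S ≤ 1 :=
  Finset.prod_le_one (fun v _ => hp0 v) (fun v _ => hp1 v)

/-- `S ⊆ S' ⟹ P(S') ≤ P(S)` (the `p(v) ≤ 1`). [cite: FordGreenKonyaginMaynardTao2018, (4.10)–(4.14)] -/
theorem pw_anti [DecidableEq V] {p : V → ℝ} (hp0 : ∀ v, 0 ≤ p v) (hp1 : ∀ v, p v ≤ 1)
    {S S' : Finset V}
    (h : S ⊆ S') : pw p S' ≤ pw p S := by
  unfold pw
  rw [← Finset.prod_sdiff h]
  exact mul_le_of_le_one_left (Finset.prod_nonneg fun v _ => hp0 v)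
    (Finset.prod_le_one (fun v _ => hp0 v) (fun v _ => hp1 v))

/-- `P(S) ≥ κ^{#S}` when `p(v) ≥ κ ≥ 0` ((5.1) «`P_j(ẽ) ≥ κ^{#ẽ}`»).
[cite: FordGreenKonyaginMaynardTao2018, §5 display (5.1)] -/
theorem pow_card_le_pw {p : V → ℝ} {κ : ℝ} (hκ : 0 ≤ κ) (hp : ∀ v, κ ≤ p v) (S : Finset V) :
    κ ^ #S ≤ pw p S := by
  unfold pw
  calc κ ^ #S = ∏ _v ∈ S, κ := by simp
    _ ≤ ∏ v ∈ S, p v := Finset.prod_le_prod (fun _ _ => hκ) (fun v _ => hp v)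

/-- `p(v) P(S ∖ {v}) = P(S)` for `v ∈ S`. [cite: FordGreenKonyaginMaynardTao2018, (4.14)] -/
theorem mul_pw_erase [DecidableEq V] (p : V → ℝ) {S : Finset V} {v : V} (hv : v ∈ S) :
    p v * pw p (S.erase v) = pw p S :=
  Finset.mul_prod_erase S p hv

/-- `1/P(X) ≤ 1 + θ⁻¹ #X` when `P(X) ≥ θ > 0` and `P(∅) = 1` («the denominator is `1` if
`ẽ ∩ ê = ∅`, and is at least `κ^r` otherwise»). [cite: FordGreenKonyaginMaynardTao2018, §5 proof of Lemma 5.1] -/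
theorem inv_pw_le_one_add {p : V → ℝ} {θ : ℝ} (hθ0 : 0 < θ) {X : Finset V} (hX : θ ≤ pw p X) :
    1 / pw p X ≤ 1 + θ⁻¹ * #X := by
  rcases X.eq_empty_or_nonempty with h | h
  · simp [h]
  · have h1 : (1 : ℝ) ≤ #X := by exact_mod_cast h.card_pos
    have hP : 0 < pw p X := lt_of_lt_of_le hθ0 hX
    calc 1 / pw p X ≤ 1 / θ := div_le_div_of_nonneg_left zero_le_one hθ0 hX
      _ = θ⁻¹ * 1 := by ring
      _ ≤ θ⁻¹ * #X := mul_le_mul_of_nonneg_left h1 (inv_nonneg.2 hθ0.le)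
      _ ≤ 1 + θ⁻¹ * #X := by linarith [mul_nonneg (inv_nonneg.2 hθ0.le) (zero_le_one.trans h1)]

end Weights

section Membership

variable {V : Type*} [Fintype V] [DecidableEq V]

/-! ### Membership probabilities as indicator sums; counting identities -/

/-- `P(v ∈ 𝐞) = ∑_S 1_{v ∈ S} P(𝐞 = S)`. [cite: FordGreenKonyaginMaynardTao2018, (4.7)] -/
theorem probMem_eq_sum_ite (μ : Finset V → ℝ) (v : V) :
    probMem μ v = ∑ S, if v ∈ S then μ S else 0 := by
  rw [probMem, Finset.sum_filter]

/-- `P(v₁, v₂ ∈ 𝐞) = ∑_S 1_{v₁, v₂ ∈ S} P(𝐞 = S)`. [cite: FordGreenKonyaginMaynardTao2018, (4.8)] -/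
theorem probPairMem_eq_sum_ite (μ : Finset V → ℝ) (v₁ v₂ : V) :
    probPairMem μ v₁ v₂ = ∑ S, if v₁ ∈ S ∧ v₂ ∈ S then μ S else 0 := by
  rw [probPairMem, Finset.sum_filter]

/-- [cite: FordGreenKonyaginMaynardTao2018, (4.8)] -/
theorem probPairMem_comm (μ : Finset V → ℝ) (v₁ v₂ : V) :
    probPairMem μ v₁ v₂ = probPairMem μ v₂ v₁ := by
  simp only [probPairMem_eq_sum_ite, and_comm]

/-- [cite: FordGreenKonyaginMaynardTao2018, (4.7)] -/
theorem probMem_nonneg {μ : Finset V → ℝ} (hμ : ∀ S, 0 ≤ μ S) (v : V) : 0 ≤ probMem μ v := by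
  rw [probMem_eq_sum_ite]
  exact Finset.sum_nonneg fun S _ => by split_ifs <;> simp [hμ S]

/-- [cite: FordGreenKonyaginMaynardTao2018, (4.8)] -/
theorem probPairMem_nonneg {μ : Finset V → ℝ} (hμ : ∀ S, 0 ≤ μ S) (v₁ v₂ : V) :
    0 ≤ probPairMem μ v₁ v₂ := by
  rw [probPairMem_eq_sum_ite]
  exact Finset.sum_nonneg fun S _ => by split_ifs <;> simp [hμ S]

omit [Fintype V] in
/-- `∑_{v ∈ e} 1_{v ∈ S} = #(S ∩ e)`. [cite: FordGreenKonyaginMaynardTao2018, §5 (union bound)] -/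
theorem sum_ite_mem_eq_card_inter (S e : Finset V) :
    ∑ v ∈ e, (if v ∈ S then (1 : ℝ) else 0) = #(S ∩ e) := by
  rw [Finset.sum_boole, Finset.filter_mem_eq_inter, Finset.inter_comm]

/-- `E #(𝐞 ∩ e) = ∑_{v ∈ e} P(v ∈ 𝐞)` («by (4.7) and a union bound»).
[cite: FordGreenKonyaginMaynardTao2018, §5 proof of Lemma 5.1] -/
theorem sum_mul_card_inter (μ : Finset V → ℝ) (e : Finset V) :
    ∑ S, μ S * #(S ∩ e) = ∑ v ∈ e, probMem μ v := by
  simp_rw [probMem_eq_sum_ite]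
  rw [Finset.sum_comm]
  refine Finset.sum_congr rfl fun S _ => ?_
  rw [← sum_ite_mem_eq_card_inter, Finset.mul_sum]
  refine Finset.sum_congr rfl fun v _ => ?_
  split_ifs <;> simp

omit [Fintype V] in
/-- `∑_{w ∈ e ∖ {v}} 1_{v, w ∈ S} = 1_{v ∈ S} #((S ∩ e) ∖ {v})`.
[cite: FordGreenKonyaginMaynardTao2018, §5 (inclusion–exclusion)] -/
theorem sum_ite_pair_eq (S e : Finset V) (v : V) :
    ∑ w ∈ e.erase v, (if v ∈ S ∧ w ∈ S then (1 : ℝ) else 0) =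
      if v ∈ S then (#((S ∩ e).erase v) : ℝ) else 0 := by
  by_cases hv : v ∈ S
  · simp only [hv, true_and, if_true]
    rw [Finset.sum_boole]
    congr 2
    ext w
    simp only [Finset.mem_filter, Finset.mem_erase, Finset.mem_inter]
    tauto
  · simp [hv]

/-- `E 1_{v ∈ 𝐞} #((𝐞 ∩ e) ∖ {v}) = ∑_{w ∈ e ∖ {v}} P(v, w ∈ 𝐞)` («by (4.8)»).
[cite: FordGreenKonyaginMaynardTao2018, §5 (inclusion–exclusion and (5.10))] -/
theorem sum_mul_ite_card_erase (μ : Finset V → ℝ) (e : Finset V) (v : V) :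
    ∑ S, μ S * (if v ∈ S then (#((S ∩ e).erase v) : ℝ) else 0) =
      ∑ w ∈ e.erase v, probPairMem μ v w := by
  simp_rw [probPairMem_eq_sum_ite]
  rw [Finset.sum_comm]
  refine Finset.sum_congr rfl fun S _ => ?_
  rw [← sum_ite_pair_eq, Finset.mul_sum]
  refine Finset.sum_congr rfl fun w _ => ?_
  split_ifs <;> simp

omit [Fintype V] in
/-- Inclusion–exclusion count: `#(S ∩ e) − 1_{S ∩ e ≠ ∅} ≤ ∑_{v ∈ e} ∑_{w ∈ e ∖ {v}} 1_{v, w ∈ S}`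
(`= k(k − 1)` with `k = #(S ∩ e)`). [cite: FordGreenKonyaginMaynardTao2018, §5 (inclusion–exclusion)] -/
theorem card_sub_ite_le_sum_pairs (S e : Finset V) :
    (#(S ∩ e) : ℝ) - (if (S ∩ e).Nonempty then 1 else 0) ≤
      ∑ v ∈ e, ∑ w ∈ e.erase v, (if v ∈ S ∧ w ∈ S then (1 : ℝ) else 0) := by
  simp_rw [sum_ite_pair_eq]
  rw [← Finset.sum_filter, Finset.filter_mem_eq_inter, ← Finset.inter_comm S e]
  have hk : ∀ v ∈ S ∩ e, (#((S ∩ e).erase v) : ℝ) = #(S ∩ e) - 1 := by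
    intro v hv
    rw [Finset.card_erase_of_mem hv]
    have h1 : 1 ≤ #(S ∩ e) := Finset.card_pos.2 ⟨v, hv⟩
    push_cast [Nat.cast_sub h1]
    ring
  rw [Finset.sum_congr rfl hk, Finset.sum_const, nsmul_eq_mul]
  split_ifs with h
  · have h1 : (1 : ℝ) ≤ #(S ∩ e) := by exact_mod_cast h.card_pos
    nlinarith
  · rw [Finset.not_nonempty_iff_eq_empty] at h
    simp [h]

end Membership

/-! ### Markov / Chebyshev for weighted finite sums (Lemma 4.1) -/

/-- **Markov's inequality** for nonnegative weights `g` on a finite set: if `h ≥ 0` and `h ≥ t` on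
the event `E`, then `g(E) ≤ (∑ g h)/t`. (Chebyshev's inequality, Lemma 4.1 of the paper, is the case
`h = (X − a)²`, `t = c²`.) [cite: FordGreenKonyaginMaynardTao2018, Lemma 4.1] -/
theorem weighted_markov {Ω : Type*} (s : Finset Ω) {g h : Ω → ℝ} (E : Ω → Prop) [DecidablePred E]
    {t : ℝ} (ht : 0 < t) (hg : ∀ ω ∈ s, 0 ≤ g ω) (hh : ∀ ω ∈ s, 0 ≤ h ω)
    (hE : ∀ ω ∈ s, E ω → t ≤ h ω) :
    ∑ ω ∈ s.filter E, g ω ≤ (∑ ω ∈ s, g ω * h ω) / t := by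
  rw [le_div_iff₀ ht, Finset.sum_filter, Finset.sum_mul]
  refine Finset.sum_le_sum fun ω hω => ?_
  split_ifs with hEω
  · exact mul_le_mul_of_nonneg_left (hE ω hω hEω) (hg ω hω)
  · simpa using mul_nonneg (hg ω hω) (hh ω hω)

/-- **Chebyshev's inequality** (Lemma 4.1): `g(|X − a| > c) ≤ (∑ g (X − a)²)/c²`.
[cite: FordGreenKonyaginMaynardTao2018, Lemma 4.1] -/
theorem weighted_chebyshev {Ω : Type*} (s : Finset Ω) {g : Ω → ℝ} (X : Ω → ℝ) (a : ℝ) {c : ℝ}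
    (hc : 0 < c) (hg : ∀ ω ∈ s, 0 ≤ g ω) :
    ∑ ω ∈ s.filter (fun ω => c < |X ω - a|), g ω ≤ (∑ ω ∈ s, g ω * (X ω - a) ^ 2) / c ^ 2 := by
  refine weighted_markov s _ (pow_pos hc 2) hg (fun ω _ => sq_nonneg _) fun ω _ hω => ?_
  have h := sq_abs (X ω - a)
  rw [← h]
  exact pow_le_pow_left₀ hc.le hω.le 2

/-! ### Taylor facts -/

/-- `1 − u ≤ e^{−u}`. [cite: FordGreenKonyaginMaynardTao2018, §5 («From Taylor's expansion»)] -/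
private theorem one_sub_le_exp_neg' (u : ℝ) : 1 - u ≤ Real.exp (-u) := by
  linarith [Real.add_one_le_exp (-u)]

/-- `e^{−(u + 2u²)} ≤ 1 − u` for `0 ≤ u ≤ 1/2` (Taylor expansion of `log(1 − u)`).
[cite: FordGreenKonyaginMaynardTao2018, §5 («From Taylor's expansion»)] -/
private theorem exp_neg_add_sq_le_one_sub {u : ℝ} (h0 : 0 ≤ u) (h1 : u ≤ 1 / 2) :
    Real.exp (-(u + 2 * u ^ 2)) ≤ 1 - u := by
  have hu1 : |u| < 1 := by rw [abs_of_nonneg h0]; linarith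
  have h := Real.abs_log_sub_add_sum_range_le hu1 1
  simp only [Finset.sum_range_one, zero_add, pow_one, Nat.cast_zero, div_one] at h
  rw [abs_of_nonneg h0] at h
  norm_num at h
  have h2 : u ^ 2 / (1 - u) ≤ 2 * u ^ 2 := by
    rw [div_le_iff₀ (by linarith)]
    nlinarith [mul_nonneg (sq_nonneg u) (by linarith : (0 : ℝ) ≤ 1 - 2 * u)]
  have h3 := (abs_le.1 (h.trans h2)).1
  rw [← Real.le_log_iff_exp_le (by linarith)]
  linarith

/-- The product sandwich `exp(−∑(uᵢ + 2uᵢ²)) ≤ ∏ (1 − uᵢ) ≤ exp(−∑ uᵢ)` for `0 ≤ uᵢ ≤ 1/2`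
(«we may factor `Y(W)` as `∏ (1 − P(e ∩ 𝐞'_i ≠ ∅ | W))` … From Taylor's expansion»).
[cite: FordGreenKonyaginMaynardTao2018, §5 (factorisation of `Y(W)`)] -/
theorem prod_one_sub_bounds {ι' : Type*} (s : Finset ι') (u : ι' → ℝ) (h0 : ∀ i ∈ s, 0 ≤ u i)
    (h1 : ∀ i ∈ s, u i ≤ 1 / 2) :
    Real.exp (-∑ i ∈ s, (u i + 2 * u i ^ 2)) ≤ ∏ i ∈ s, (1 - u i) ∧
      ∏ i ∈ s, (1 - u i) ≤ Real.exp (-∑ i ∈ s, u i) := by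
  constructor
  · rw [← Finset.sum_neg_distrib, Real.exp_sum]
    exact Finset.prod_le_prod (fun i _ => (Real.exp_pos _).le)
      fun i hi => exp_neg_add_sq_le_one_sub (h0 i hi) (h1 i hi)
  · rw [← Finset.sum_neg_distrib, Real.exp_sum]
    exact Finset.prod_le_prod (fun i hi => by linarith [h1 i hi]) fun i _ => one_sub_le_exp_neg' _

/-- `|1/x − 1| ≤ 2t` when `|x − 1| ≤ t ≤ 1/2` («`1_{F_i}/X_i = 1 + O(δ^{1/(3·10^m)})`», display (5.3)).
[cite: FordGreenKonyaginMaynardTao2018, §5 display (5.3)] -/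
theorem abs_inv_sub_one_le {x t : ℝ} (ht : t ≤ 1 / 2) (h : |x - 1| ≤ t) :
    |1 / x - 1| ≤ 2 * t := by
  have h1 := abs_le.1 h
  have hx : 1 / 2 ≤ x := by linarith
  have hx0 : 0 < x := by linarith
  rw [show 1 / x - 1 = (1 - x) / x by field_simp, abs_div, abs_of_pos hx0, div_le_iff₀ hx0,
    abs_sub_comm]
  calc |x - 1| ≤ t := h
    _ = 2 * t * (1 / 2) := by ring
    _ ≤ 2 * t * x := mul_le_mul_of_nonneg_left hx (by linarith [abs_nonneg (x - 1)])

/-- `e^x ≤ 1 + 2x` for `0 ≤ x ≤ 1`. [cite: FordGreenKonyaginMaynardTao2018, §5 («From Taylor's expansion»)] -/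
private theorem exp_le_one_add_two_mul {x : ℝ} (h0 : 0 ≤ x) (h1 : x ≤ 1) : Real.exp x ≤ 1 + 2 * x := by
  have h := Real.abs_exp_sub_one_sub_id_le (show |x| ≤ 1 by rw [abs_of_nonneg h0]; exact h1)
  have h2 := (abs_le.1 h).2
  nlinarith

/-- `1 − e^{−x} ≤ x`. [cite: FordGreenKonyaginMaynardTao2018, §5 («From Taylor's expansion»)] -/
private theorem one_sub_exp_neg_le (x : ℝ) : 1 - Real.exp (-x) ≤ x := by
  linarith [one_sub_le_exp_neg' x]

/-- Upper factor of the final sandwich: `e^{x}(1 + η) − 1 ≤ 2x + 3η` for `0 ≤ x ≤ 1`, `0 ≤ η`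
(«`Y(W) = (1 + O(…)) exp(−…)`» combined with «`P(e ⊂ W) = (1 + O_≤(δ^{1/10^m})) P_{m−1}(e)`»).
[cite: FordGreenKonyaginMaynardTao2018, §5 displays (5.4)–(5.6)] -/
theorem exp_mul_one_add_sub_one_le {x η : ℝ} (hx0 : 0 ≤ x) (hx1 : x ≤ 1) (hη0 : 0 ≤ η) :
    Real.exp x * (1 + η) - 1 ≤ 2 * x + 3 * η := by
  have h := exp_le_one_add_two_mul hx0 hx1
  nlinarith [Real.exp_pos x]

/-- Lower factor of the final sandwich: `1 − e^{−x}(1 − η) ≤ x + η` for `0 ≤ x`, `0 ≤ η`.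
[cite: FordGreenKonyaginMaynardTao2018, §5 displays (5.4)–(5.6)] -/
theorem one_sub_exp_neg_mul_le {x η : ℝ} (hx0 : 0 ≤ x) (hη0 : 0 ≤ η) :
    1 - Real.exp (-x) * (1 - η) ≤ x + η := by
  have h := one_sub_exp_neg_le x
  have h1 : Real.exp (-x) ≤ 1 := by
    rw [Real.exp_le_one_iff]; linarith
  nlinarith [Real.exp_pos (-x)]

end FGKMTCovering

end Literature.Combinatorics.Hypergraph
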